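import Summits.PneNP.PneNP.Theorems.BavardGapPlantedGlueR
import Literature.Probability.Distributions.IndepProductLawDistance
import HarnessLib.Audit

/-!
# Crux `BavardGapUncertifiable` (stmt-PneNP-2491) — line `split` (crux-strategist cstrat-stmt-PneNP-2491-r1)

BC2 REDIRECT of the restated deciding crux `X = BavardGapUncertifiable` of route `BavardGap`:
`X ⇐ X₁ ∧ X₂` with `X₁ = FirstOrderGap` (stmt-PneNP-2492), `X₂ = PlantedGenusPseudorandomR`
(stmt-PneNP-10857), the assembly being the PROVED route item `PlantedGlueR`
(`Summit.PneNP.PneNP.Theorems.bavardGap_plantedGlueR_proof`, Theorems/BavardGapPlantedGlueR.lean).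
This skeleton gives each piece its own two-stub line and composes them with the proved glue, so that
`BavardGapUncertifiable_of` concludes the crux BY NAME from four registered stubs:

* piece `X₁` (line "sharp threshold + positive excess"): `stub_thresholdSharpness` (for every notch `q`:
  failure of `pg ≤ θ + θ/q` with non-vanishing probability infinitely often ⇒ failure of `pg ≤ θ + θ/(2q)` with
  probability `→ 1`; the no-oscillation / concentration half, true whatever the `cl`-constant is) and
  `stub_positiveExcess` (for some `q, δ > 0`, infinitely often `Pr[pg > θ + θ/q] ≥ δ`; the strictly weaker,
  constructive form of the gap); `FirstOrderGap_of` is proved (witness `2q`).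
  DEAD END recorded in the line card: the first-moment / valence-census line (`4·orb ≤ N + 3·fix + 2·c₂ + c₃`)
  — its census event contains "some pairing has `≤ 4θ_q − 2` bands", which is NOT rare (average band length
  `¾ log₃ n < log₃ n`), and the plain first moment of low-genus pairings is exponentially large above genus `θ/2`
  (the tree's proved constant `1/12`, `CalegariWalker2013_sclLowerTail`).
* piece `X₂` (line "size-biased planting"): the canonical planted law `sizeBiased q n` = code of the
  word-marginal of a UNIFORM pair `(w, π)`, `w` reduced balanced of length `2n`, `π` an admissible
  pairing of genus `≤ θ(2n)(1 + 1/q)` (the analogue of `G(n,1/2,k)`, whose law is size-biased by the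
  number of planted structures); `stub_sizeBiasedSampler` (an exactly polynomial-time sampler whose law
  is eventually supported on low-genus codes and tends to `sizeBiased` in statistical distance) and
  `stub_sizeBiasedPseudorandom` (every PPT test has advantage `< 1/5` infinitely often against the
  uniform reduced balanced word); `PlantedGenusPseudorandomR_of` is proved (kernel contraction of
  `PMF.tvDist`, `PMF.abs_toReal_toOuterMeasure_bind_sub_le_tvDist`, and the triangle inequality:
  `1/20 + 1/5 = 1/4`).
-/

set_option linter.dupNamespace false

namespace Summit.PneNP.PneNP.Cruxes.BavardGapUncertifiable.Split

open Filter
open Summit.PneNP.PneNP.Theses.BavardGap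
open scoped Classical

/-! ## Piece X₁ = `FirstOrderGap` — line "sharp threshold + positive excess" -/

/-- Statement of `stub_thresholdSharpness` (see its docstring). -/
def ThresholdSharpness : Prop :=
  ∀ q : ℕ, 0 < q → (∃ δ : ℝ, 0 < δ ∧ ∃ᶠ n in Filter.atTop, ((((Finset.univ.filter fun w : Fin ((2 * n)) → Fin 2 × Bool => FreeGroup.reduce (List.ofFn w) = List.ofFn w ∧ ∀ a : Fin 2, (Finset.univ.filter fun i => w i = (a, true)).card = (Finset.univ.filter fun i => w i = (a, false)).card)).filter fun w => (∃ π : Equiv.Perm (Fin (List.ofFn w).length), (∀ i, π (π i) = i) ∧ (∀ i, π i ≠ i) ∧ (∀ i, (List.ofFn w).get (π i) = (((List.ofFn w).get i).1, !((List.ofFn w).get i).2)) ∧ (List.ofFn w).length / 2 + 1 ≤ 2 * (((2 * n)) / (6 * Nat.log 3 ((2 * n))) + ((2 * n)) / (6 * Nat.log 3 ((2 * n))) / q) + (Multiset.card (Equiv.Perm.cycleType ((finRotate (List.ofFn w).length).trans π)) + (Finset.univ.filter fun c => ((finRotate (List.ofFn w).length).trans π) c = c).card))).card : ℝ) / (((Finset.univ.filter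 fun w : Fin ((2 * n)) → Fin 2 × Bool => FreeGroup.reduce (List.ofFn w) = List.ofFn w ∧ ∀ a : Fin 2, (Finset.univ.filter fun i => w i = (a, true)).card = (Finset.univ.filter fun i => w i = (a, false)).card)).card : ℝ) ≤ 1 - δ) → Filter.Tendsto (fun n : ℕ => ((((Finset.univ.filter fun w : Fin ((2 * n)) → Fin 2 × Bool => FreeGroup.reduce (List.ofFn w) = List.ofFn w ∧ ∀ a : Fin 2, (Finset.univ.filter fun i => w i = (a, true)).card = (Finset.univ.filter fun i => w i = (a, false)).card)).filter fun w => (∃ π : Equiv.Perm (Fin (List.ofFn w).length), (∀ i, π (π i) = i) ∧ (∀ i, π i ≠ i) ∧ (∀ i, (List.ofFn w).get (π i) = (((List.ofFn w).get i).1, !((List.ofFn w).get i).2)) ∧ (List.ofFn w).length / 2 + 1 ≤ 2 * (((2 * n)) / (6 * Nat.log 3 ((2 * n))) + ((2 * n)) / (6 * Nat.log 3 ((2 * n))) / (2 * q)) + (Multiset.card (Equiv.Perm.cycleType ((finRotate (List.ofFn w).length).trans π)) + (Finset.univ.filter fun c => ((finRotate (List.ofFn w).length).trans π) c = c).card))).card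 : ℝ) / (((Finset.univ.filter fun w : Fin ((2 * n)) → Fin 2 × Bool => FreeGroup.reduce (List.ofFn w) = List.ofFn w ∧ ∀ a : Fin 2, (Finset.univ.filter fun i => w i = (a, true)).card = (Finset.univ.filter fun i => w i = (a, false)).card)).card : ℝ)) Filter.atTop (nhds 0)

/-- Statement of `stub_positiveExcess` (see its docstring). -/
def PositiveExcess : Prop :=
  ∃ q : ℕ, 0 < q ∧ ∃ δ : ℝ, 0 < δ ∧ ∃ᶠ n in Filter.atTop, ((((Finset.univ.filter fun w : Fin ((2 * n)) → Fin 2 × Bool => FreeGroup.reduce (List.ofFn w) = List.ofFn w ∧ ∀ a : Fin 2, (Finset.univ.filter fun i => w i = (a, true)).card = (Finset.univ.filter fun i => w i = (a, false)).card)).filter fun w => (∃ π : Equiv.Perm (Fin (List.ofFn w).length), (∀ i, π (π i) = i) ∧ (∀ i, π i ≠ i) ∧ (∀ i, (List.ofFn w).get (π i) = (((List.ofFn w).get i).1, !((List.ofFn w).get i).2)) ∧ (List.ofFn w).length / 2 + 1 ≤ 2 * (((2 * n)) / (6 * Nat.log 3 ((2 * n))) + ((2 * n)) / (6 * Nat.log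 3 ((2 * n))) / q) + (Multiset.card (Equiv.Perm.cycleType ((finRotate (List.ofFn w).length).trans π)) + (Finset.univ.filter fun c => ((finRotate (List.ofFn w).length).trans π) c = c).card))).card : ℝ) / (((Finset.univ.filter fun w : Fin ((2 * n)) → Fin 2 × Bool => FreeGroup.reduce (List.ofFn w) = List.ofFn w ∧ ∀ a : Fin 2, (Finset.univ.filter fun i => w i = (a, true)).card = (Finset.univ.filter fun i => w i = (a, false)).card)).card : ℝ) ≤ 1 - δ

/-- **stub (X₁, structure of the genus threshold).** THRESHOLD SHARPNESS / NO OSCILLATION: for every `q ≥ 1`,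
if the event `pg(w) ≤ θ(2n) + θ(2n)/q` FAILS with non-vanishing probability along some subsequence
(`Pr ≤ 1 − δ` infinitely often), then one notch lower it fails with high probability for ALL large `n`:
`Pr[pg(w) ≤ θ(2n) + θ(2n)/(2q)] → 0`. This is what random rigidity of `cl` itself would give (concentration of
`cl(w)·log|w|/|w|` at SOME constant `c ∈ [log 3/6, log 3/4]`, cf. CalegariWalker2013 Thm 4.1 for `scl` and the
tree's `four_mul_cl_le_of_goodChunks` ceiling), and it holds whatever that constant is — in particular also in
the world `cl ∼ scl` where `FirstOrderGap` is false (the hypothesis is then never met). Content: bounded-difference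
concentration of `cl` under local moves of the word (window `o(n / log n)`) AND non-oscillation of the normalised
median in `n`. Size L. -/
theorem stub_thresholdSharpness : ThresholdSharpness := by
  sorry

/-- **stub (X₁, the arithmetic heart, in its weakest form).** POSITIVE-PROBABILITY EXCESS: for some `q ≥ 1` and
`δ > 0`, infinitely often a uniform reduced balanced word of length `2n` has pairing genus `> θ(2n) + θ(2n)/q`
with probability at least `δ`. Strictly weaker than `FirstOrderGap` (positive probability, infinitely often,
instead of probability `→ 1` eventually) — so constructive: it suffices to exhibit events of probability `≥ δ`
(CLT-scale deficits of the inverse-repeat supply at band length `½ log₃(2n)`, or a second-moment lower bound on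
a single-sheet obstruction count) on which every once-bordered fatgraph is inefficient. False iff
`cl(w) ≤ (1 + o(1)) scl(w)` with probability `→ 1` (the filed refuting side `ClAsymptoticToScl`). Size L;
conjecture-grade. -/
theorem stub_positiveExcess : PositiveExcess := by
  sorry

namespace Registered
/-- Alias of `ThresholdSharpness` keyed by the registered stub name (device of
`Cruxes/Capture/Lines/csp-spine-meet-to-join.lean`: the skeleton audit admits hypotheses by stub NAME). -/
abbrev stub_thresholdSharpness : Prop := ThresholdSharpness
/-- Alias of `PositiveExcess` keyed by the registered stub name. -/
abbrev stub_positiveExcess : Prop := PositiveExcess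
end Registered

/-- **Piece X₁ from its stubs** (sharpness at the notch `q` where the excess has positive probability gives the
high-probability gap at notch `2q`). -/
theorem FirstOrderGap_of
    (hD : Registered.stub_thresholdSharpness)
    (hL : Registered.stub_positiveExcess) :
    FirstOrderGap := by
  unfold FirstOrderGap
  obtain ⟨q, hq, δ, hδ, hfreq⟩ := hL
  exact ⟨2 * q, by omega, hD q hq ⟨δ, hδ, hfreq⟩⟩

/-! ## Piece X₂ = `PlantedGenusPseudorandomR` — line "size-biased planting" -/

/-- The planting threshold `θ(2n) + θ(2n)/q`, `θ(m) = m / (6 ⌊log₃ m⌋)` (verbatim the route's term). -/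
def thr (n q : ℕ) : ℕ := ((2 * n)) / (6 * Nat.log 3 ((2 * n))) + ((2 * n)) / (6 * Nat.log 3 ((2 * n))) / q

/-- The multiset of 2-bit codes of MARKED words: one copy of `code w` for every pair `(w, π)` with `w`
reduced balanced of length `2n` and `π` an admissible pairing of `w` of genus `≤ thr n q`. -/
noncomputable def markedCodes (q n : ℕ) : Multiset (List Bool) :=
  ((Finset.univ : Finset (Σ w : Fin (2 * n) → Fin 2 × Bool, Equiv.Perm (Fin (List.ofFn w).length))).filter
      fun p => p.1 ∈ (Finset.univ.filter fun w : Fin ((2 * n)) → Fin 2 × Bool => FreeGroup.reduce (List.ofFn w) = List.ofFn w ∧ ∀ a : Fin 2, (Finset.univ.filter fun i => w i = (a, true)).card = (Finset.univ.filter fun i => w i = (a, false)).card) ∧ ((∀ i, p.2 (p.2 i) = i) ∧ (∀ i, p.2 i ≠ i) ∧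
        (∀ i, (List.ofFn p.1).get (p.2 i) = (((List.ofFn p.1).get i).1, !((List.ofFn p.1).get i).2)) ∧
        (List.ofFn p.1).length / 2 + 1 ≤ 2 * thr n q +
          (Multiset.card (Equiv.Perm.cycleType ((finRotate (List.ofFn p.1).length).trans p.2)) +
            (Finset.univ.filter fun c => ((finRotate (List.ofFn p.1).length).trans p.2) c = c).card))).val.map
    fun p => (List.ofFn p.1).flatMap fun a => [decide (a.1 = 1), a.2]

/-- **The size-biased planted law** `PL*_(q,n)`: the code of the word-marginal of a uniformly random marked
word `(w, π)` (so `Pr[w] ∝ #admissible pairings of w of genus ≤ θ_q`), with the route's junk convention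
`pure []` when no marked word exists (only for `2n ∈ {0,2,4,10}`). -/
noncomputable def sizeBiased (q n : ℕ) : PMF (List Bool) :=
  if h : markedCodes q n = 0 then PMF.pure [] else PMF.ofMultiset (markedCodes q n) h

/-- Statement of `stub_sizeBiasedSampler` (see its docstring). -/
def SizeBiasedSamplable : Prop :=
  ∀ q : ℕ, 0 < q → ∃ S : Literature.Computability.Complexity.RandAlg ℕ (List Bool), S.IsPolyTime Computability.unaryEncodeNat id ∧ (∀ᶠ n in Filter.atTop, ∀ x ∈ (S.outputPMF Computability.unaryEncodeNat n).support, ∃ w : Fin (2 * n) → Fin 2 × Bool, w ∈ (Finset.univ.filter fun w : Fin ((2 * n)) → Fin 2 × Bool => FreeGroup.reduce (List.ofFn w) = List.ofFn w ∧ ∀ a : Fin 2, (Finset.univ.filter fun i => w i = (a, true)).card = (Finset.univ.filter fun i => w i = (a, false)).card) ∧ x = ((List.ofFn w).flatMap fun a => [decide (a.1 = 1), a.2]) ∧ (∃ π : Equiv.Perm (Fin (List.ofFn w).length), (∀ i, π (π i) = i) ∧ (∀ i, π i ≠ i) ∧ (∀ i, (List.ofFn w).get (π i) = (((List.ofFn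 w).get i).1, !((List.ofFn w).get i).2)) ∧ (List.ofFn w).length / 2 + 1 ≤ 2 * (((2 * n)) / (6 * Nat.log 3 ((2 * n))) + ((2 * n)) / (6 * Nat.log 3 ((2 * n))) / q) + (Multiset.card (Equiv.Perm.cycleType ((finRotate (List.ofFn w).length).trans π)) + (Finset.univ.filter fun c => ((finRotate (List.ofFn w).length).trans π) c = c).card))) ∧ Filter.Tendsto (fun n : ℕ => (S.outputPMF Computability.unaryEncodeNat n).tvDist (sizeBiased q n)) Filter.atTop (nhds 0)

/-- Statement of `stub_sizeBiasedPseudorandom` (see its docstring). -/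
def SizeBiasedPseudorandom : Prop :=
  ∀ q : ℕ, 0 < q → ∀ D : Literature.Computability.Complexity.RandAlg (List Bool) Bool, D.IsPolyTime id Computability.encodeBool → ∃ᶠ n in Filter.atTop, |(((sizeBiased q n).bind fun s => D.outputPMF id (Literature.Computability.Complexity.boolPair (Computability.unaryEncodeNat n) s)) true).toReal - ((((if h : ((Finset.univ.filter fun w : Fin ((2 * n)) → Fin 2 × Bool => FreeGroup.reduce (List.ofFn w) = List.ofFn w ∧ ∀ a : Fin 2, (Finset.univ.filter fun i => w i = (a, true)).card = (Finset.univ.filter fun i => w i = (a, false)).card)).Nonempty then (PMF.uniformOfFinset ((Finset.univ.filter fun w : Fin ((2 * n)) → Fin 2 × Bool => FreeGroup.reduce (List.ofFn w) = List.ofFn w ∧ ∀ a : Fin 2, (Finset.univ.filter fun i => w i = (a, true)).card = (Finset.univ.filter fun i => w i = (a, false)).card)) h).map (fun w => ((List.ofFn w).flatMap fun a => [decide (a.1 = 1), a.2])) else PMF.pure [])).bind fun s => D.outputPMF id (Literature.Computability.Complexity.boolPair (Computability.unaryEncodeNat n) s)) true).toReal| < 1 / 5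

/-- **stub (X₂, algorithmic).** SIZE-BIASED PLANTING IS SAMPLABLE: for every `q ≥ 1` there is an exactly
polynomial-time sampler `S` on input `1ⁿ` whose output law is, for all large `n`, supported on codes of
reduced balanced words of length `2n` carrying an admissible pairing of genus `≤ θ(2n)(1 + 1/q)`, and whose
statistical distance to `sizeBiased q n` tends to `0`. Why plausible: low-genus band diagrams are
near-planar unicellular maps with `≤ 6θ` bands (exactly countable/samplable by the Harer–Zagier recursion and
Chapuy's bijection), and the reducedness conditioning is a bounded-degree constraint along the boundary; the
negligible defect absorbs rounding of the exact counts to coin flips. Size L (a sampler + its analysis). -/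
theorem stub_sizeBiasedSampler : SizeBiasedSamplable := by
  sorry

/-- **stub (X₂, the computational heart).** SIZE-BIASED PLANTING IS PSEUDORANDOM: for every `q ≥ 1` and every
PPT test `D`, infinitely often `|Pr[D(1ⁿ, PL*_(q,n)) = 1] − Pr[D(1ⁿ, NULL_n) = 1]| < 1/5` (NULL = uniform
reduced balanced word of length `2n`, coded; verbatim the route's term). This is the planted-clique-type
hardness claim for the CANONICAL planting; under `FirstOrderGap` at this `q` it cannot hold statistically
(the planted support is NULL-negligible), so it is genuinely computational. Size L / conjecture-grade. -/
theorem stub_sizeBiasedPseudorandom : SizeBiasedPseudorandom := by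
  sorry

namespace Registered
/-- Alias of `SizeBiasedSamplable` keyed by the registered stub name. -/
abbrev stub_sizeBiasedSampler : Prop := SizeBiasedSamplable
/-- Alias of `SizeBiasedPseudorandom` keyed by the registered stub name. -/
abbrev stub_sizeBiasedPseudorandom : Prop := SizeBiasedPseudorandom
end Registered


/-- **Piece X₂ from its stubs** (`PL := law of S`; advantage `≤ Δ(S, PL*) + adv(PL*) < 1/20 + 1/5 = 1/4`). -/
theorem PlantedGenusPseudorandomR_of
    (hS : Registered.stub_sizeBiasedSampler)
    (hM : Registered.stub_sizeBiasedPseudorandom) :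
    PlantedGenusPseudorandomR := by
  unfold PlantedGenusPseudorandomR
  intro q hq
  obtain ⟨S, hpoly, hsupp, htv⟩ := hS q hq
  refine ⟨S.outputPMF Computability.unaryEncodeNat, ⟨S, hpoly, fun n => rfl⟩, hsupp, ?_⟩
  intro D hD
  have hev : ∀ᶠ n in Filter.atTop, (S.outputPMF Computability.unaryEncodeNat n).tvDist (sizeBiased q n) < 1 / 20 :=
    (tendsto_order.1 htv).2 _ (by norm_num)
  refine ((hM q hq D hD).and_eventually hev).mono ?_
  rintro n ⟨h1, h2⟩
  have h3 := PMF.abs_toReal_toOuterMeasure_bind_sub_le_tvDist (S.outputPMF Computability.unaryEncodeNat n)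
    (sizeBiased q n)
    (fun s => D.outputPMF id (Literature.Computability.Complexity.boolPair (Computability.unaryEncodeNat n) s))
    {true}
  rw [PMF.toOuterMeasure_apply_singleton, PMF.toOuterMeasure_apply_singleton] at h3
  refine (abs_sub_le _ (((sizeBiased q n).bind fun s => D.outputPMF id (Literature.Computability.Complexity.boolPair (Computability.unaryEncodeNat n) s)) true).toReal _).trans_lt ?_
  linarith

/-! ## The crux from the four stubs -/

/-- **`BavardGapUncertifiable` from the two lines**, through the PROVED assembly `PlantedGlueR`
(`bavardGap_plantedGlueR_proof : FirstOrderGap → PlantedGenusPseudorandomR → BavardGapUncertifiable`). -/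
theorem BavardGapUncertifiable_of
    (h₁ : Registered.stub_thresholdSharpness) (h₂ : Registered.stub_positiveExcess)
    (h₃ : Registered.stub_sizeBiasedSampler) (h₄ : Registered.stub_sizeBiasedPseudorandom) :
    BavardGapUncertifiable :=
  Summit.PneNP.PneNP.Theorems.bavardGap_plantedGlueR_proof (FirstOrderGap_of h₁ h₂)
    (PlantedGenusPseudorandomR_of h₃ h₄)

end Summit.PneNP.PneNP.Cruxes.BavardGapUncertifiable.Split
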